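import Summits.CriticalPhenomena.PercolationContinuityZ3.Theorems.PercNearOneGluingNoHeavyLowerTailKnQuestion8CoefficientwiseNCAGlue
import HarnessLib

/-!
# NC-DOWN is closed under gluing at the ROOT — prim-lf-2 gen 65

Support file (`--supports stmt-CriticalPhenomena-4575`, closed), prover `prim-lf-2` (gen 65).  No definitions, no named facts, no sorries; standard axioms.
Memo `prim-lf-2/CW-NCDOWN-gen65.md` §2 (CONJECTURE NC-DOWN) and §2.4(b) (closure questions); companion `…CoefficientwiseNCDownCycle.lean` (`ncDown_cycle`).

CONJECTURE NC-DOWN (prim-lf-2 gen 65): for every finite multigraph, root `x`, monotone `f, g` and every ANTITONE predicate `D` on pairs of vertex sets,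
`0 ≤ Σ_{s : D (K s ∪ B s) (K s ∩ B s)} (f (K s) − f (B s))(g (K s) − g (B s))` (`K s = C_x(s)`, `B s = C_x(E∖s)`).  It is verified exactly for all rooted graphs on ≤ 5
vertices and by a census on all rooted graphs with ≤ 7 vertices; it contains NCA / NC* / NO-CORE.  Here: the NC-DOWN class is closed under gluing two edge sets AT THE ROOT
(edges of `E₁` and `E₂` share only `x`): then `K = K₁ ∪ K₂`, `B = B₁ ∪ B₂`, `M = M₁ ∪ M₂`, `Z = Z₁ ∪ Z₂`; pairing `s₂` with `E₂ ∖ s₂` and the decoration identity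
`(α−β)(α′−β′) + (γ−δ)(γ′−δ′) = (α−δ)(γ′−β′) + (γ−β)(α′−δ′) + (α−γ)(α′−γ′) + (δ−β)(δ′−β′)` (gen 55) turn the sum into NC-DOWN sums of `(E₁, x)` for the antitone
predicates `D(· ∪ M₂, · ∪ Z₂)` with the glued monotone pairs `(f(· ∪ K₂), g(· ∪ B₂))`, `(f(· ∪ B₂), g(· ∪ K₂))`, plus NC-DOWN sums of `(E₂, x)`.  (Whether NC-DOWN is closed
under gluing at a NON-root cut vertex is open: the bookkeeping of `nca_glue` needs antitone differences of the weight, memo §2.4(b).)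
* `Coefficientwise.ncDown_glue_root`.  With `ncDown_cycle`: NC-DOWN holds on every bouquet of cycles (and digons/bridges) at the root.
[cite: KozmaNitzan2024, Questions 8–9 (§5.5 p. 36) (context: the Question-8 pocket covariance programme)]
-/

namespace Summit.CriticalPhenomena.PercolationContinuityZ3.Theorems

open Finset Literature.Probability.Percolation

namespace Coefficientwise

variable {ι V : Type*} [DecidableEq ι]

open Classical in
/-- **NC-DOWN is closed under gluing at the root.**  Let `E₁, E₂` be disjoint edge sets whose edges can only share the vertex `x`.  If for every antitone predicate `D'`
and all monotone `φ, ψ` the `D'`-sums of `(E₁, x)` and of `(E₂, x)` are nonnegative, then so are those of `(E₁ ∪ E₂, x)`.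
[cite: KozmaNitzan2024, Questions 8–9 (§5.5 p. 36) (context)] -/
theorem ncDown_glue_root (ends : ι → Sym2 V) {E₁ E₂ : Finset ι} (hE : Disjoint E₁ E₂) {x : V}
    (hsep : ∀ e ∈ E₁, ∀ e' ∈ E₂, ∀ w : V, w ∈ ends e → w ∈ ends e' → w = x)
    (h₁ : ∀ (D' : Set V → Set V → Prop), (∀ M Z M' Z', D' M Z → M' ⊆ M → Z' ⊆ Z → D' M' Z') → ∀ (φ ψ : Set V → ℝ), Monotone φ → Monotone ψ →
      0 ≤ ∑ s ∈ E₁.powerset.filter (fun s : Finset ι =>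
            D' (openCluster (ends '' (↑s : Set ι)) x ∪ openCluster (ends '' (↑(E₁ \ s) : Set ι)) x)
               (openCluster (ends '' (↑s : Set ι)) x ∩ openCluster (ends '' (↑(E₁ \ s) : Set ι)) x)),
        (φ (openCluster (ends '' (↑s : Set ι)) x) - φ (openCluster (ends '' (↑(E₁ \ s) : Set ι)) x)) *
          (ψ (openCluster (ends '' (↑s : Set ι)) x) - ψ (openCluster (ends '' (↑(E₁ \ s) : Set ι)) x)))
    (h₂ : ∀ (D' : Set V → Set V → Prop), (∀ M Z M' Z', D' M Z → M' ⊆ M → Z' ⊆ Z → D' M' Z') → ∀ (φ ψ : Set V → ℝ), Monotone φ → Monotone ψ →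
      0 ≤ ∑ s ∈ E₂.powerset.filter (fun s : Finset ι =>
            D' (openCluster (ends '' (↑s : Set ι)) x ∪ openCluster (ends '' (↑(E₂ \ s) : Set ι)) x)
               (openCluster (ends '' (↑s : Set ι)) x ∩ openCluster (ends '' (↑(E₂ \ s) : Set ι)) x)),
        (φ (openCluster (ends '' (↑s : Set ι)) x) - φ (openCluster (ends '' (↑(E₂ \ s) : Set ι)) x)) *
          (ψ (openCluster (ends '' (↑s : Set ι)) x) - ψ (openCluster (ends '' (↑(E₂ \ s) : Set ι)) x)))
    (D : Set V → Set V → Prop) (hD : ∀ M Z M' Z', D M Z → M' ⊆ M → Z' ⊆ Z → D M' Z')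
    (f g : Set V → ℝ) (hf : Monotone f) (hg : Monotone g) :
    0 ≤ ∑ s ∈ (E₁ ∪ E₂).powerset.filter (fun s : Finset ι =>
            D (openCluster (ends '' (↑s : Set ι)) x ∪ openCluster (ends '' (↑((E₁ ∪ E₂) \ s) : Set ι)) x)
              (openCluster (ends '' (↑s : Set ι)) x ∩ openCluster (ends '' (↑((E₁ ∪ E₂) \ s) : Set ι)) x)),
      (f (openCluster (ends '' (↑s : Set ι)) x) - f (openCluster (ends '' (↑((E₁ ∪ E₂) \ s) : Set ι)) x)) *
        (g (openCluster (ends '' (↑s : Set ι)) x) - g (openCluster (ends '' (↑((E₁ ∪ E₂) \ s) : Set ι)) x)) := by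
  set K : Finset ι → Set V := fun s => openCluster (ends '' (↑s : Set ι)) x with hK
  change 0 ≤ ∑ s ∈ (E₁ ∪ E₂).powerset.filter (fun s => D (K s ∪ K ((E₁ ∪ E₂) \ s)) (K s ∩ K ((E₁ ∪ E₂) \ s))),
      (f (K s) - f (K ((E₁ ∪ E₂) \ s))) * (g (K s) - g (K ((E₁ ∪ E₂) \ s)))
  have h₁' : ∀ (D' : Set V → Set V → Prop), (∀ M Z M' Z', D' M Z → M' ⊆ M → Z' ⊆ Z → D' M' Z') → ∀ (φ ψ : Set V → ℝ), Monotone φ → Monotone ψ →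
      0 ≤ ∑ s ∈ E₁.powerset.filter (fun s => D' (K s ∪ K (E₁ \ s)) (K s ∩ K (E₁ \ s))), (φ (K s) - φ (K (E₁ \ s))) * (ψ (K s) - ψ (K (E₁ \ s))) := h₁
  have h₂' : ∀ (D' : Set V → Set V → Prop), (∀ M Z M' Z', D' M Z → M' ⊆ M → Z' ⊆ Z → D' M' Z') → ∀ (φ ψ : Set V → ℝ), Monotone φ → Monotone ψ →
      0 ≤ ∑ s ∈ E₂.powerset.filter (fun s => D' (K s ∪ K (E₂ \ s)) (K s ∩ K (E₂ \ s))), (φ (K s) - φ (K (E₂ \ s))) * (ψ (K s) - ψ (K (E₂ \ s))) := h₂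
  have hxK : ∀ s : Finset ι, x ∈ K s := fun s => mem_openCluster_self _ x
  -- clusters of the two pieces meet only at `x`
  have meet : ∀ s₁ t₂ : Finset ι, s₁ ⊆ E₁ → t₂ ⊆ E₂ → ∀ w : V, w ∈ K s₁ → w ∈ K t₂ → w = x := by
    intro s₁ t₂ hs₁ ht₂ w hw1 hw2
    by_contra hne
    obtain ⟨e, he, hwe⟩ := exists_edge_of_mem_openCluster ends hw1 hne
    obtain ⟨e', he', hwe'⟩ := exists_edge_of_mem_openCluster ends hw2 hne
    exact hne (hsep e (hs₁ he) e' (ht₂ he') w hwe hwe')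
  -- gluing at the root: `K (s₁ ∪ s₂) = K s₁ ∪ K s₂`
  have decomp : ∀ s₁ s₂ : Finset ι, s₁ ⊆ E₁ → s₂ ⊆ E₂ → K (s₁ ∪ s₂) = K s₁ ∪ K s₂ := by
    intro s₁ s₂ hs₁ hs₂
    ext w
    rw [Set.mem_union]
    rw [show (w ∈ K (s₁ ∪ s₂)) = (w ∈ openCluster (ends '' (↑(s₁ ∪ s₂) : Set ι)) x) from rfl,
      mem_openCluster_union_glue ends (fun e he e' he' w hw hw' => hsep e (hs₁ he) e' (hs₂ he') w hw hw') (fun e _ _ => rfl) w]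
    constructor
    · rintro (h | ⟨_, h⟩)
      · exact Or.inl h
      · exact Or.inr h
    · rintro (h | h)
      · exact Or.inl h
      · exact Or.inr ⟨hxK s₁, h⟩
  -- the footprint and the core split
  have hM : ∀ s₁ s₂ : Finset ι, s₁ ⊆ E₁ → s₂ ⊆ E₂ →
      (K s₁ ∪ K s₂) ∪ (K (E₁ \ s₁) ∪ K (E₂ \ s₂)) = (K s₁ ∪ K (E₁ \ s₁)) ∪ (K s₂ ∪ K (E₂ \ s₂)) := by
    intro s₁ s₂ _ _; ext w; simp only [Set.mem_union]; tauto
  have hZ : ∀ s₁ s₂ : Finset ι, s₁ ⊆ E₁ → s₂ ⊆ E₂ →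
      (K s₁ ∪ K s₂) ∩ (K (E₁ \ s₁) ∪ K (E₂ \ s₂)) = (K s₁ ∩ K (E₁ \ s₁)) ∪ (K s₂ ∩ K (E₂ \ s₂)) := by
    intro s₁ s₂ hs₁ hs₂; ext w; simp only [Set.mem_union, Set.mem_inter_iff]
    constructor
    · rintro ⟨h1 | h1, h2 | h2⟩
      · exact Or.inl ⟨h1, h2⟩
      · have hw : w = x := meet s₁ (E₂ \ s₂) hs₁ Finset.sdiff_subset w h1 h2
        rw [hw]; exact Or.inl ⟨hxK _, hxK _⟩
      · have hw : w = x := meet (E₁ \ s₁) s₂ Finset.sdiff_subset hs₂ w h2 h1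
        rw [hw]; exact Or.inl ⟨hxK _, hxK _⟩
      · exact Or.inr ⟨h1, h2⟩
    · rintro (⟨h1, h2⟩ | ⟨h1, h2⟩)
      · exact ⟨Or.inl h1, Or.inl h2⟩
      · exact ⟨Or.inr h1, Or.inr h2⟩
  -- the sum as a double sum in glued form
  simp only [Finset.sum_filter]
  rw [DualBHK.sum_powerset_union hE]
  have hsummand : ∀ s₁ ∈ E₁.powerset, ∀ s₂ ∈ E₂.powerset,
      (if D (K (s₁ ∪ s₂) ∪ K ((E₁ ∪ E₂) \ (s₁ ∪ s₂))) (K (s₁ ∪ s₂) ∩ K ((E₁ ∪ E₂) \ (s₁ ∪ s₂)))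
        then (f (K (s₁ ∪ s₂)) - f (K ((E₁ ∪ E₂) \ (s₁ ∪ s₂)))) * (g (K (s₁ ∪ s₂)) - g (K ((E₁ ∪ E₂) \ (s₁ ∪ s₂)))) else 0)
      = (if D ((K s₁ ∪ K (E₁ \ s₁)) ∪ (K s₂ ∪ K (E₂ \ s₂))) ((K s₁ ∩ K (E₁ \ s₁)) ∪ (K s₂ ∩ K (E₂ \ s₂)))
        then (f (K s₁ ∪ K s₂) - f (K (E₁ \ s₁) ∪ K (E₂ \ s₂))) * (g (K s₁ ∪ K s₂) - g (K (E₁ \ s₁) ∪ K (E₂ \ s₂))) else 0) := by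
    intro s₁ hs₁ s₂ hs₂
    have hs₁' := Finset.mem_powerset.mp hs₁
    have hs₂' := Finset.mem_powerset.mp hs₂
    have hKc : K ((E₁ ∪ E₂) \ (s₁ ∪ s₂)) = K (E₁ \ s₁) ∪ K (E₂ \ s₂) := by
      rw [union_sdiff_union_of_subset hE hs₁' hs₂']
      exact decomp (E₁ \ s₁) (E₂ \ s₂) Finset.sdiff_subset Finset.sdiff_subset
    rw [decomp s₁ s₂ hs₁' hs₂', hKc, hM s₁ s₂ hs₁' hs₂', hZ s₁ s₂ hs₁' hs₂']
  rw [Finset.sum_congr rfl fun s₁ hs₁ => Finset.sum_congr rfl fun s₂ hs₂ => hsummand s₁ hs₁ s₂ hs₂]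
  -- abbreviations
  set M₁ : Finset ι → Set V := fun s₁ => K s₁ ∪ K (E₁ \ s₁) with hM₁
  set Z₁ : Finset ι → Set V := fun s₁ => K s₁ ∩ K (E₁ \ s₁) with hZ₁
  set M₂ : Finset ι → Set V := fun s₂ => K s₂ ∪ K (E₂ \ s₂) with hM₂
  set Z₂ : Finset ι → Set V := fun s₂ => K s₂ ∩ K (E₂ \ s₂) with hZ₂
  change 0 ≤ ∑ s₁ ∈ E₁.powerset, ∑ s₂ ∈ E₂.powerset,
      (if D (M₁ s₁ ∪ M₂ s₂) (Z₁ s₁ ∪ Z₂ s₂)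
        then (f (K s₁ ∪ K s₂) - f (K (E₁ \ s₁) ∪ K (E₂ \ s₂))) * (g (K s₁ ∪ K s₂) - g (K (E₁ \ s₁) ∪ K (E₂ \ s₂))) else 0)
  -- flip invariance of `M₂, Z₂`
  have hss₂ : ∀ s₂ : Finset ι, s₂ ⊆ E₂ → E₂ \ (E₂ \ s₂) = s₂ := fun s₂ h => Finset.sdiff_sdiff_eq_self h
  have hM₂c : ∀ s₂ : Finset ι, s₂ ⊆ E₂ → M₂ (E₂ \ s₂) = M₂ s₂ := by
    intro s₂ h; simp only [hM₂, hss₂ s₂ h, Set.union_comm]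
  have hZ₂c : ∀ s₂ : Finset ι, s₂ ⊆ E₂ → Z₂ (E₂ \ s₂) = Z₂ s₂ := by
    intro s₂ h; simp only [hZ₂, hss₂ s₂ h, Set.inter_comm]
  -- the four pieces of the decoration identity
  set X₁ : Finset ι → Finset ι → ℝ := fun s₁ s₂ =>
    (f (K s₁ ∪ K s₂) - f (K (E₁ \ s₁) ∪ K s₂)) * (g (K s₁ ∪ K (E₂ \ s₂)) - g (K (E₁ \ s₁) ∪ K (E₂ \ s₂))) with hX₁
  set X₂ : Finset ι → Finset ι → ℝ := fun s₁ s₂ =>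
    (f (K s₁ ∪ K (E₂ \ s₂)) - f (K (E₁ \ s₁) ∪ K (E₂ \ s₂))) * (g (K s₁ ∪ K s₂) - g (K (E₁ \ s₁) ∪ K s₂)) with hX₂
  set Y₁ : Finset ι → Finset ι → ℝ := fun s₁ s₂ =>
    (f (K s₁ ∪ K s₂) - f (K s₁ ∪ K (E₂ \ s₂))) * (g (K s₁ ∪ K s₂) - g (K s₁ ∪ K (E₂ \ s₂))) with hY₁
  set Y₂ : Finset ι → Finset ι → ℝ := fun s₁ s₂ =>
    (f (K (E₁ \ s₁) ∪ K s₂) - f (K (E₁ \ s₁) ∪ K (E₂ \ s₂))) * (g (K (E₁ \ s₁) ∪ K s₂) - g (K (E₁ \ s₁) ∪ K (E₂ \ s₂))) with hY₂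
  set Tm : Finset ι → Finset ι → ℝ := fun s₁ s₂ =>
    (f (K s₁ ∪ K s₂) - f (K (E₁ \ s₁) ∪ K (E₂ \ s₂))) * (g (K s₁ ∪ K s₂) - g (K (E₁ \ s₁) ∪ K (E₂ \ s₂))) with hTm
  have decor : ∀ s₁ s₂ : Finset ι, s₂ ⊆ E₂ → Tm s₁ s₂ + Tm s₁ (E₂ \ s₂) = X₁ s₁ s₂ + X₂ s₁ s₂ + Y₁ s₁ s₂ + Y₂ s₁ s₂ := by
    intro s₁ s₂ h
    simp only [hTm, hX₁, hX₂, hY₁, hY₂, hss₂ s₂ h]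
    ring
  -- pair `s₂` with `E₂ ∖ s₂`: the double sum equals half the sum of the paired terms
  have inner : ∀ s₁ ∈ E₁.powerset,
      ∑ s₂ ∈ E₂.powerset, (if D (M₁ s₁ ∪ M₂ s₂) (Z₁ s₁ ∪ Z₂ s₂) then Tm s₁ s₂ else 0)
        = (1 / 2 : ℝ) * ∑ s₂ ∈ E₂.powerset, (if D (M₁ s₁ ∪ M₂ s₂) (Z₁ s₁ ∪ Z₂ s₂) then X₁ s₁ s₂ + X₂ s₁ s₂ + Y₁ s₁ s₂ + Y₂ s₁ s₂ else 0) := by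
    intro s₁ _
    have flip : ∑ s₂ ∈ E₂.powerset, (if D (M₁ s₁ ∪ M₂ s₂) (Z₁ s₁ ∪ Z₂ s₂) then Tm s₁ (E₂ \ s₂) else 0)
        = ∑ s₂ ∈ E₂.powerset, (if D (M₁ s₁ ∪ M₂ s₂) (Z₁ s₁ ∪ Z₂ s₂) then Tm s₁ s₂ else 0) := by
      have := sum_powerset_sdiff E₂ (fun s₂ => if D (M₁ s₁ ∪ M₂ s₂) (Z₁ s₁ ∪ Z₂ s₂) then Tm s₁ s₂ else 0)
      rw [← this]
      refine Finset.sum_congr rfl fun s₂ hs₂ => ?_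
      have h := Finset.mem_powerset.mp hs₂
      simp only [hM₂c s₂ h, hZ₂c s₂ h]
    have hsum : ∑ s₂ ∈ E₂.powerset, (if D (M₁ s₁ ∪ M₂ s₂) (Z₁ s₁ ∪ Z₂ s₂) then X₁ s₁ s₂ + X₂ s₁ s₂ + Y₁ s₁ s₂ + Y₂ s₁ s₂ else 0)
        = ∑ s₂ ∈ E₂.powerset, (if D (M₁ s₁ ∪ M₂ s₂) (Z₁ s₁ ∪ Z₂ s₂) then Tm s₁ s₂ else 0)
          + ∑ s₂ ∈ E₂.powerset, (if D (M₁ s₁ ∪ M₂ s₂) (Z₁ s₁ ∪ Z₂ s₂) then Tm s₁ (E₂ \ s₂) else 0) := by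
      rw [← Finset.sum_add_distrib]
      refine Finset.sum_congr rfl fun s₂ hs₂ => ?_
      have h := Finset.mem_powerset.mp hs₂
      by_cases hc : D (M₁ s₁ ∪ M₂ s₂) (Z₁ s₁ ∪ Z₂ s₂)
      · rw [if_pos hc, if_pos hc, if_pos hc, ← decor s₁ s₂ h]
      · rw [if_neg hc, if_neg hc, if_neg hc, add_zero]
    rw [hsum, flip]; ring
  rw [Finset.sum_congr rfl inner, ← Finset.mul_sum]
  refine mul_nonneg (by norm_num) ?_
  -- split into the four families of sums
  have split : ∀ s₁ ∈ E₁.powerset, ∑ s₂ ∈ E₂.powerset, (if D (M₁ s₁ ∪ M₂ s₂) (Z₁ s₁ ∪ Z₂ s₂) then X₁ s₁ s₂ + X₂ s₁ s₂ + Y₁ s₁ s₂ + Y₂ s₁ s₂ else 0)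
      = ∑ s₂ ∈ E₂.powerset, (if D (M₁ s₁ ∪ M₂ s₂) (Z₁ s₁ ∪ Z₂ s₂) then X₁ s₁ s₂ else 0)
        + ∑ s₂ ∈ E₂.powerset, (if D (M₁ s₁ ∪ M₂ s₂) (Z₁ s₁ ∪ Z₂ s₂) then X₂ s₁ s₂ else 0)
        + ∑ s₂ ∈ E₂.powerset, (if D (M₁ s₁ ∪ M₂ s₂) (Z₁ s₁ ∪ Z₂ s₂) then Y₁ s₁ s₂ else 0)
        + ∑ s₂ ∈ E₂.powerset, (if D (M₁ s₁ ∪ M₂ s₂) (Z₁ s₁ ∪ Z₂ s₂) then Y₂ s₁ s₂ else 0) := by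
    intro s₁ _
    rw [← Finset.sum_add_distrib, ← Finset.sum_add_distrib, ← Finset.sum_add_distrib]
    refine Finset.sum_congr rfl fun s₂ _ => ?_
    split_ifs <;> ring
  rw [Finset.sum_congr rfl split, Finset.sum_add_distrib, Finset.sum_add_distrib, Finset.sum_add_distrib]
  -- antitone predicates obtained by shifting `D`
  have hD₁ : ∀ s₂ : Finset ι, ∀ M Z M' Z' : Set V, D (M ∪ M₂ s₂) (Z ∪ Z₂ s₂) → M' ⊆ M → Z' ⊆ Z → D (M' ∪ M₂ s₂) (Z' ∪ Z₂ s₂) :=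
    fun s₂ M Z M' Z' h hM hZ => hD _ _ _ _ h (Set.union_subset_union_left _ hM) (Set.union_subset_union_left _ hZ)
  have hD₂ : ∀ s₁ : Finset ι, ∀ M Z M' Z' : Set V, D (M₁ s₁ ∪ M) (Z₁ s₁ ∪ Z) → M' ⊆ M → Z' ⊆ Z → D (M₁ s₁ ∪ M') (Z₁ s₁ ∪ Z') :=
    fun s₁ M Z M' Z' h hM hZ => hD _ _ _ _ h (Set.union_subset_union_right _ hM) (Set.union_subset_union_right _ hZ)
  -- glued monotone pairs
  have monoL : ∀ (φ : Set V → ℝ), Monotone φ → ∀ W : Set V, Monotone (fun A : Set V => φ (A ∪ W)) :=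
    fun φ hφ W A A' h => hφ (Set.union_subset_union_left W h)
  have monoR : ∀ (φ : Set V → ℝ), Monotone φ → ∀ W : Set V, Monotone (fun A : Set V => φ (W ∪ A)) :=
    fun φ hφ W A A' h => hφ (Set.union_subset_union_right W h)
  refine add_nonneg (add_nonneg (add_nonneg ?_ ?_) ?_) ?_
  · -- X₁: for each s₂ an NC-DOWN sum of E₁ with the pair (f(· ∪ K₂), g(· ∪ B₂))
    rw [Finset.sum_comm]
    refine Finset.sum_nonneg fun s₂ _ => ?_
    have := h₁' (fun M Z => D (M ∪ M₂ s₂) (Z ∪ Z₂ s₂)) (hD₁ s₂) (fun A => f (A ∪ K s₂)) (fun A => g (A ∪ K (E₂ \ s₂)))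
      (monoL f hf _) (monoL g hg _)
    rw [Finset.sum_filter] at this
    exact this
  · rw [Finset.sum_comm]
    refine Finset.sum_nonneg fun s₂ _ => ?_
    have := h₁' (fun M Z => D (M ∪ M₂ s₂) (Z ∪ Z₂ s₂)) (hD₁ s₂) (fun A => f (A ∪ K (E₂ \ s₂))) (fun A => g (A ∪ K s₂))
      (monoL f hf _) (monoL g hg _)
    rw [Finset.sum_filter] at this
    exact this
  · -- Y₁: for each s₁ an NC-DOWN sum of E₂ with the pair (f(K₁ ∪ ·), g(K₁ ∪ ·))
    refine Finset.sum_nonneg fun s₁ _ => ?_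
    have := h₂' (fun M Z => D (M₁ s₁ ∪ M) (Z₁ s₁ ∪ Z)) (hD₂ s₁) (fun A => f (K s₁ ∪ A)) (fun A => g (K s₁ ∪ A))
      (monoR f hf _) (monoR g hg _)
    rw [Finset.sum_filter] at this
    exact this
  · refine Finset.sum_nonneg fun s₁ _ => ?_
    have := h₂' (fun M Z => D (M₁ s₁ ∪ M) (Z₁ s₁ ∪ Z)) (hD₂ s₁) (fun A => f (K (E₁ \ s₁) ∪ A)) (fun A => g (K (E₁ \ s₁) ∪ A))
      (monoR f hf _) (monoR g hg _)
    rw [Finset.sum_filter] at this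
    exact this

end Coefficientwise

end Summit.CriticalPhenomena.PercolationContinuityZ3.Theorems
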